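import Summits.QuantumFields.YangMills.Theorems.LuscherReductionTwistedTraceScalingBOStiffNearSharp
import Summits.QuantumFields.YangMills.Theorems.LuscherReductionTwistedTraceScalingBOStiffSmearKernel
import Summits.QuantumFields.YangMills.Theorems.LuscherReductionTwistedTraceScalingBOStiffRing
import HarnessLib

/-!
# (B-ST) (W1-10e) `…BOStiffSmearEstimate`: the slow-smeared based kernel against the central profile is `ρ(1,u)·MΘ(x)` up to `(1±ε)` and an `e^{−K_tℓ²}` tail — step (R1) of the (A) route
# (lane A of S-BASE, crux `TwistedTraceScaling` stmt-QuantumFields-20203, C4-CORE, the (B-ST) pen; g22 HANDOFF-g22 note 5 route for (A) = spec_S3)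

`MΘ(x) = ∫ cM(x,·)cΘ dπ` (the object of the quasimode (Q±) of ✓`…BOStiffQuasimodeFrame`).  For `x ∈ cS β` and slow data `u` in the window `‖q(u_k) − 1‖ ≤ Dδ·β^{-s}`:
★★ `eventually_smear_fibre_near` — `|∫_y K̂(oT 1 x, oT u y)·cΘ(y) dπ − ρ(1,u)·MΘ(x)| ≤ ε·ρ(1,u)·MΘ(x) + e^{2β|E|}·4e^{−K_tℓ²}·∫cΘ dπ` for every `ε > 0`, `K_t ≥ 1`, eventually in `β`
(`K̂` = based kernel, `ρ(1,u) = K₁^{(L³β)}(1,u)/K₁(1,1)`; ✓`eventually_basedKernel_product_near_sharp` at `u' = 1` integrated against `cΘ ≥ 0`).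
With ✓`…BOStiffSmearKernel` this is `⟨K_β(oT 1 x,·), P₀(boFun 𝟙_W Ω_c)⟩_μ = (1±ε)·Z_W·MΘ(x) ± e^{2β|E|}4e^{−K_tℓ²}∫cΘ`, `Z_W = ∫_W ρ(1,u)dσ³(u)` (★★ `eventually_smear_near`).
HONEST FRAMING: bookkeeping for a stub of a child of the CONDITIONAL route R2b1; (Q±) OPEN; (B-ST), C4-CORE OPEN; not infinite volume, not a gap, not Clay.
-/

set_option autoImplicit false

noncomputable section

open MeasureTheory Filter Topology Real
open scoped BigOperators
open Literature.MathematicalPhysics.QuantumFieldTheory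
open Literature.MathematicalPhysics.QuantumLattice

namespace Summit.QuantumFields.YangMills.Theorems.FemtoTransferGap.TwoLattice.ConstTube

open Summit.QuantumFields.YangMills.Theorems.FemtoTransferGap
open Summit.QuantumFields.YangMills.Theorems.FemtoTransferGap.TwoLattice
open Summit.QuantumFields.YangMills.Theorems.FemtoTransferGap.TwoLattice.Avg
open Summit.QuantumFields.YangMills.Theorems.FemtoTransferGap.TwoLattice.Stiff (LinkSpace)

variable {L : ℕ} [NeZero L]

/-! ## §1 The fibre integral of the smeared based kernel -/

set_option maxHeartbeats 1600000 in
-- long record expressions.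
/-- ★★ **SMEARED KERNEL AGAINST THE PROFILE ≈ `ρ(1,u)·MΘ(x)`** (see the module docstring). [cite: Luscher1983, §3] -/
theorem eventually_smear_fibre_near {s : ℝ} (hs : 0 < s) {Dδ : ℝ} (hD : 0 ≤ Dδ) {ε : ℝ} (hε : 0 < ε) {Kt : ℝ} (hKt : 1 ≤ Kt) :
    ∀ᶠ β : ℝ in atTop, ∀ x ∈ cS L β, ∀ u : GaugeConfig 3 1 SU2, (∀ k : Fin 3, ‖su2Quat (u (0, k)) - 1‖ ≤ Dδ * powScale s β) →
      |(∫ y, (∫ h, transferKernel su2Rep β (orthoTube L 1 x) (gaugeTransform (basedExt L h) (orthoTube L u y)) ∂basedMeasure L) * cΘ L β y ∂orthoTransverse L) -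
          transferKernel su2Rep ((L : ℝ) ^ 3 * β) 1 u / transferKernel su2Rep ((L : ℝ) ^ 3 * β) (1 : GaugeConfig 3 1 SU2) 1 *
            ∫ y, cM L β x y * cΘ L β y ∂orthoTransverse L| ≤
        ε * (transferKernel su2Rep ((L : ℝ) ^ 3 * β) 1 u / transferKernel su2Rep ((L : ℝ) ^ 3 * β) (1 : GaugeConfig 3 1 SU2) 1 *
            ∫ y, cM L β x y * cΘ L β y ∂orthoTransverse L) +
          Real.exp (β * (2 * (Fintype.card (Edge 3 L) : ℝ))) * (4 * Real.exp (-(Kt * btLog β ^ 2))) * ∫ y, cΘ L β y ∂orthoTransverse L := by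
  haveI := isFiniteMeasure_orthoTransverse L
  filter_upwards [eventually_basedKernel_product_near_sharp (L := L) hs hD hε hKt, eventually_ge_atTop (0 : ℝ)] with β hβ hβ0 x hx u hu
  obtain ⟨hxcap, hxr⟩ := mem_cS hx
  obtain ⟨hMm, ⟨CM, hMb⟩, -, -, hΘm, hΘ1, hΘ0, hΘS, hSm⟩ := central_kform_data (L := L) hβ0
  obtain ⟨Mb, hMbnd⟩ := basedKernel_bounds (L := L) β
  set ρ : ℝ := transferKernel su2Rep ((L : ℝ) ^ 3 * β) 1 u / transferKernel su2Rep ((L : ℝ) ^ 3 * β) (1 : GaugeConfig 3 1 SU2) 1 with hρdef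
  set τ : ℝ := Real.exp (β * (2 * (Fintype.card (Edge 3 L) : ℝ))) * (4 * Real.exp (-(Kt * btLog β ^ 2))) with hτdef
  have hρ0 : 0 ≤ ρ := (div_pos (transferKernel_pos _ _ _ _) (transferKernel_pos _ _ _ _)).le
  have hτ0 : 0 ≤ τ := by positivity
  set F : (Edge 3 L → Fin 3 → ℝ) → ℝ := fun y => ∫ h, transferKernel su2Rep β (orthoTube L 1 x) (gaugeTransform (basedExt L h) (orthoTube L u y)) ∂basedMeasure L with hFdef
  -- measurability / integrability
  have hFm : Measurable F := by
    have h := (measurable_basedKernel_uncurry (L := L) β).comp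
      (measurable_const.prodMk (measurable_orthoTube_right (L := L) u) : Measurable fun y : Edge 3 L → Fin 3 → ℝ => (orthoTube L 1 x, orthoTube L u y))
    simpa only [Function.comp_def] using h
  have hFb : ∀ y, |F y| ≤ Mb := fun y => by
    have h := hMbnd (orthoTube L 1 x) (orthoTube L u y)
    rw [hFdef]; dsimp only; rw [abs_of_nonneg h.1]; exact h.2
  have hMx : Measurable fun y => cM L β x y := by
    have h := hMm.comp (measurable_const.prodMk measurable_id : Measurable fun y : Edge 3 L → Fin 3 → ℝ => (x, y))
    simpa only [Function.comp_def, Function.uncurry] using h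
  have hM0 : ∀ y, 0 ≤ cM L β x y := fun y => (cM_pos (L := L) β x y).le
  have hi1 : Integrable (fun y => F y * cΘ L β y) (orthoTransverse L) :=
    integrable_of_measurable_abs_le _ (hFm.mul hΘm) (C := Mb * 1) fun y => by rw [abs_mul]; exact mul_le_mul (hFb y) (hΘ1 y) (abs_nonneg _) ((abs_nonneg _).trans (hFb y))
  have hi2 : Integrable (fun y => cM L β x y * cΘ L β y) (orthoTransverse L) :=
    integrable_of_measurable_abs_le _ (hMx.mul hΘm) (C := CM * 1) fun y => by rw [abs_mul]; exact mul_le_mul (hMb x y) (hΘ1 y) (abs_nonneg _) ((abs_nonneg _).trans (hMb x y))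
  have hi3 : Integrable (fun y => cΘ L β y) (orthoTransverse L) := integrable_of_measurable_abs_le _ hΘm hΘ1
  -- pointwise: on `cS` the sharp near-product bound, off `cS` both sides vanish
  have hone : ∀ k : Fin 3, ‖su2Quat ((1 : GaugeConfig 3 1 SU2) (0, k)) - 1‖ ≤ Dδ * powScale s β := fun k => by
    rw [Pi.one_apply, Literature.MathematicalPhysics.QuantumFieldTheory.Balaban1983to89.T4HaarSU2Translate.su2Quat_one, sub_self, norm_zero]
    exact mul_nonneg hD (powScale_pos _ _).le
  have hpt : ∀ y, |F y * cΘ L β y - ρ * (cM L β x y * cΘ L β y)| ≤ ε * (ρ * (cM L β x y * cΘ L β y)) + τ * cΘ L β y := fun y => by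
    by_cases hy : y ∈ cS L β
    · obtain ⟨hycap, hyr⟩ := mem_cS hy
      have h' : |F y - ρ * cM L β x y| ≤ ε * (ρ * cM L β x y) + τ := hβ 1 u x y hxcap hycap hone hu hxr hyr
      have e : F y * cΘ L β y - ρ * (cM L β x y * cΘ L β y) = (F y - ρ * cM L β x y) * cΘ L β y := by ring
      rw [e, abs_mul, abs_of_nonneg (hΘ0 y)]
      calc |F y - ρ * cM L β x y| * cΘ L β y ≤ (ε * (ρ * cM L β x y) + τ) * cΘ L β y := mul_le_mul_of_nonneg_right h' (hΘ0 y)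
        _ = ε * (ρ * (cM L β x y * cΘ L β y)) + τ * cΘ L β y := by ring
    · rw [hΘS y hy]; simp
  -- integrate
  have hint : |∫ y, F y * cΘ L β y ∂orthoTransverse L - ρ * ∫ y, cM L β x y * cΘ L β y ∂orthoTransverse L| ≤
      ∫ y, (ε * (ρ * (cM L β x y * cΘ L β y)) + τ * cΘ L β y) ∂orthoTransverse L := by
    rw [← integral_const_mul, ← integral_sub hi1 (hi2.const_mul ρ)]
    refine (abs_integral_le_integral_abs).trans (integral_mono_of_nonneg (ae_of_all _ fun y => abs_nonneg _) ?_ (ae_of_all _ hpt))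
    exact ((hi2.const_mul ρ).const_mul ε).add (hi3.const_mul τ)
  rw [integral_add ((hi2.const_mul ρ).const_mul ε) (hi3.const_mul τ), integral_const_mul, integral_const_mul, integral_const_mul] at hint
  exact hint

/-! ## §2 The slow integral: the smeared form is `Z_W·MΘ(x)` up to `(1±ε)` and the tail -/

set_option maxHeartbeats 1600000 in
-- long record expressions.
/-- ★★ **THE SMEARED FORM ≈ `Z_W·MΘ(x)`**: with `W(β) = {u | ∀k, ‖q(u_k)−1‖ ≤ Dδβ^{-s}}`, `Z_W = ∫_W ρ(1,u) dσ³(u)`, for `x ∈ cS β`, eventually: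
`|∫_u 𝟙_W(u)·(∫_y K̂(oT 1 x, oT u y) cΘ(y) dπ) dσ³ − Z_W·MΘ(x)| ≤ ε·Z_W·MΘ(x) + e^{2β|E|}4e^{−K_tℓ²}∫cΘ`. [cite: Luscher1983, §3] -/
theorem eventually_smear_near {s : ℝ} (hs : 0 < s) {Dδ : ℝ} (hD : 0 ≤ Dδ) {ε : ℝ} (hε : 0 < ε) {Kt : ℝ} (hKt : 1 ≤ Kt) :
    ∀ᶠ β : ℝ in atTop, ∀ x ∈ cS L β,
      |(∫ u, {u : GaugeConfig 3 1 SU2 | ∀ k : Fin 3, ‖su2Quat (u (0, k)) - 1‖ ≤ Dδ * powScale s β}.indicator (fun _ => (1 : ℝ)) u *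
            (∫ y, (∫ h, transferKernel su2Rep β (orthoTube L 1 x) (gaugeTransform (basedExt L h) (orthoTube L u y)) ∂basedMeasure L) * cΘ L β y ∂orthoTransverse L)
          ∂configMeasure SU2 1) -
          (∫ u, {u : GaugeConfig 3 1 SU2 | ∀ k : Fin 3, ‖su2Quat (u (0, k)) - 1‖ ≤ Dδ * powScale s β}.indicator (fun _ => (1 : ℝ)) u *
              (transferKernel su2Rep ((L : ℝ) ^ 3 * β) 1 u / transferKernel su2Rep ((L : ℝ) ^ 3 * β) (1 : GaugeConfig 3 1 SU2) 1) ∂configMeasure SU2 1) *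
            ∫ y, cM L β x y * cΘ L β y ∂orthoTransverse L| ≤
        ε * ((∫ u, {u : GaugeConfig 3 1 SU2 | ∀ k : Fin 3, ‖su2Quat (u (0, k)) - 1‖ ≤ Dδ * powScale s β}.indicator (fun _ => (1 : ℝ)) u *
              (transferKernel su2Rep ((L : ℝ) ^ 3 * β) 1 u / transferKernel su2Rep ((L : ℝ) ^ 3 * β) (1 : GaugeConfig 3 1 SU2) 1) ∂configMeasure SU2 1) *
            ∫ y, cM L β x y * cΘ L β y ∂orthoTransverse L) +
          Real.exp (β * (2 * (Fintype.card (Edge 3 L) : ℝ))) * (4 * Real.exp (-(Kt * btLog β ^ 2))) * ∫ y, cΘ L β y ∂orthoTransverse L := by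
  haveI := isFiniteMeasure_orthoTransverse L
  filter_upwards [eventually_smear_fibre_near (L := L) hs hD hε hKt, eventually_ge_atTop (0 : ℝ)] with β hβ hβ0 x hx
  obtain ⟨hMm, ⟨CM, hMb⟩, -, -, hΘm, hΘ1, hΘ0, hΘS, hSm⟩ := central_kform_data (L := L) hβ0
  obtain ⟨Mb, hMbnd⟩ := basedKernel_bounds (L := L) β
  set W : Set (GaugeConfig 3 1 SU2) := {u | ∀ k : Fin 3, ‖su2Quat (u (0, k)) - 1‖ ≤ Dδ * powScale s β} with hWdef
  have hWm : MeasurableSet W := measurableSet_slowWindow' _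
  set ρ : GaugeConfig 3 1 SU2 → ℝ := fun u => transferKernel su2Rep ((L : ℝ) ^ 3 * β) 1 u / transferKernel su2Rep ((L : ℝ) ^ 3 * β) (1 : GaugeConfig 3 1 SU2) 1 with hρdef
  set τ : ℝ := Real.exp (β * (2 * (Fintype.card (Edge 3 L) : ℝ))) * (4 * Real.exp (-(Kt * btLog β ^ 2))) with hτdef
  set MΘ : ℝ := ∫ y, cM L β x y * cΘ L β y ∂orthoTransverse L with hMΘ
  set IΘ : ℝ := ∫ y, cΘ L β y ∂orthoTransverse L with hIΘ
  set J : GaugeConfig 3 1 SU2 → ℝ := fun u =>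
    ∫ y, (∫ h, transferKernel su2Rep β (orthoTube L 1 x) (gaugeTransform (basedExt L h) (orthoTube L u y)) ∂basedMeasure L) * cΘ L β y ∂orthoTransverse L with hJdef
  have hτ0 : 0 ≤ τ := by positivity
  have hρ0 : ∀ u, 0 ≤ ρ u := fun u => (div_pos (transferKernel_pos _ _ _ _) (transferKernel_pos _ _ _ _)).le
  have hρ1 : ∀ u, ρ u ≤ 1 := fun u => (rho_le_exp_neg (L := L) hβ0 1 u 0).trans (Real.exp_le_one_iff.mpr (neg_nonpos.mpr (by positivity)))
  have hρm : Measurable ρ := ((continuous_transferKernel su2Rep continuous_su2Rep _).measurable.comp (measurable_const.prodMk measurable_id)).div_const _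
  have hMΘ0 : 0 ≤ MΘ := integral_nonneg fun y => mul_nonneg (basedIntegral_nonneg β _ _) (hΘ0 y)
  have hIΘ0 : 0 ≤ IΘ := integral_nonneg fun y => hΘ0 y
  -- `J` is measurable and bounded
  have hJm : Measurable J := by
    have h3 : Measurable fun p : GaugeConfig 3 1 SU2 × (Edge 3 L → Fin 3 → ℝ) =>
        (∫ h, transferKernel su2Rep β (orthoTube L 1 x) (gaugeTransform (basedExt L h) (orthoTube L p.1 p.2)) ∂basedMeasure L) * cΘ L β p.2 := by
      have h := (measurable_basedKernel_uncurry (L := L) β).comp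
        (measurable_const.prodMk (measurable_orthoTube (L := L)) : Measurable fun p : GaugeConfig 3 1 SU2 × (Edge 3 L → Fin 3 → ℝ) => (orthoTube L 1 x, orthoTube L p.1 p.2))
      have h' : Measurable fun p : GaugeConfig 3 1 SU2 × (Edge 3 L → Fin 3 → ℝ) =>
          ∫ h, transferKernel su2Rep β (orthoTube L 1 x) (gaugeTransform (basedExt L h) (orthoTube L p.1 p.2)) ∂basedMeasure L := by
        simpa only [Function.comp_def] using h
      exact h'.mul (hΘm.comp measurable_snd)
    have h := (h3.stronglyMeasurable.integral_prod_right' (ν := orthoTransverse L)).measurable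
    simpa only using h
  have hMb0 : 0 ≤ Mb := (hMbnd (1 : GaugeConfig 3 L SU2) 1).1.trans (hMbnd (1 : GaugeConfig 3 L SU2) 1).2
  have hJb : ∀ u, |J u| ≤ Mb * 1 * (orthoTransverse L).real Set.univ := fun u => by
    have h := norm_integral_le_of_norm_le_const (μ := orthoTransverse L)
      (f := fun y => (∫ h, transferKernel su2Rep β (orthoTube L 1 x) (gaugeTransform (basedExt L h) (orthoTube L u y)) ∂basedMeasure L) * cΘ L β y) (C := Mb * 1)
      (Filter.Eventually.of_forall fun y => by
        rw [Real.norm_eq_abs, abs_mul, abs_of_nonneg (hMbnd (orthoTube L 1 x) (orthoTube L u y)).1]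
        exact mul_le_mul (hMbnd (orthoTube L 1 x) (orthoTube L u y)).2 (hΘ1 y) (abs_nonneg _) hMb0)
    rw [Real.norm_eq_abs] at h; linarith [h]
  have hi1 : Integrable (fun u => W.indicator (fun _ => (1 : ℝ)) u * J u) (configMeasure SU2 1) :=
    integrable_of_measurable_abs_le _ ((measurable_const.indicator hWm).mul hJm) (C := 1 * (Mb * 1 * (orthoTransverse L).real Set.univ)) fun u => by
      rw [abs_mul]; refine mul_le_mul ?_ (hJb u) (abs_nonneg _) zero_le_one
      by_cases hu : u ∈ W
      · rw [Set.indicator_of_mem hu, abs_one]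
      · rw [Set.indicator_of_notMem hu, abs_zero]; exact zero_le_one
  have hi2 : Integrable (fun u => W.indicator (fun _ => (1 : ℝ)) u * ρ u) (configMeasure SU2 1) :=
    integrable_of_measurable_abs_le _ ((measurable_const.indicator hWm).mul hρm) (C := 1 * 1) fun u => by
      rw [abs_mul, abs_of_nonneg (hρ0 u)]; refine mul_le_mul ?_ (hρ1 u) (hρ0 u) zero_le_one
      by_cases hu : u ∈ W
      · rw [Set.indicator_of_mem hu, abs_one]
      · rw [Set.indicator_of_notMem hu, abs_zero]; exact zero_le_one
  -- pointwise in `u`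
  have hpt : ∀ u, |W.indicator (fun _ => (1 : ℝ)) u * J u - W.indicator (fun _ => (1 : ℝ)) u * ρ u * MΘ| ≤
      ε * (W.indicator (fun _ => (1 : ℝ)) u * ρ u * MΘ) + τ * IΘ := fun u => by
    by_cases hu : u ∈ W
    · rw [Set.indicator_of_mem hu, one_mul, one_mul]
      exact hβ x hx u hu
    · rw [Set.indicator_of_notMem hu]; simp only [zero_mul, sub_self, abs_zero, mul_zero, zero_add]; positivity
  have hint : |(∫ u, W.indicator (fun _ => (1 : ℝ)) u * J u ∂configMeasure SU2 1) - (∫ u, W.indicator (fun _ => (1 : ℝ)) u * ρ u ∂configMeasure SU2 1) * MΘ| ≤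
      ∫ u, (ε * (W.indicator (fun _ => (1 : ℝ)) u * ρ u * MΘ) + τ * IΘ) ∂configMeasure SU2 1 := by
    rw [← integral_mul_const, ← integral_sub hi1 (hi2.mul_const MΘ)]
    refine (abs_integral_le_integral_abs).trans (integral_mono_of_nonneg (ae_of_all _ fun u => abs_nonneg _) ?_ (ae_of_all _ hpt))
    exact (((hi2.mul_const MΘ)).const_mul ε).add (integrable_const _)
  rw [integral_add ((hi2.mul_const MΘ).const_mul ε) (integrable_const _), integral_const_mul, integral_mul_const, integral_const, smul_eq_mul,
    probReal_univ, one_mul] at hint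
  exact hint

end Summit.QuantumFields.YangMills.Theorems.FemtoTransferGap.TwoLattice.ConstTube

end
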